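import Literature.Analysis.UnboundedOperators.LinearizedBoltzmannDirectionalForms
import Literature.Probability.Distributions.GaussianWickSpace
import Literature.Probability.Distributions.GaussianRectangleForm
import Literature.Algebra.Polynomial.FischerNumberOperator
import HarnessLib

/-!
# The spectral gap of the pseudo-Maxwellian rectangle form on Wick polynomials

Let `E` be a finite-dimensional real inner product space of dimension `d ≥ 2`, `γ` its standard
Gaussian, `σ` the surface measure of the unit sphere, `b` an orthonormal basis indexed by `ι`.
For a Wick polynomial `g = 𝓗_b p` and a direction `ω ∈ S^{d-1}` let
`R_p(ω) = ∫ (R_ω g)² d((γ₁⊗γ₁)⊗(γ⊗γ))` be the rectangle form of `GaussianRectangleForm`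
(`R_ω g = g(cω+Pz) - g(sω+Pz) - g(cω+Pz_*) + g(sω+Pz_*)`). We prove the **polynomial spectral gap**

`∫_S R_p(ω) dσ(ω) ≥ κ_d ‖p‖²_F`, `κ_d = 16 σ(S) (d-1) / (3 d (d+2))` (`lintegral_sphere_rectForm_ge`)

for every `p` orthogonal to the collision invariants, i.e. with vanishing components of degree
`0` and `1` and harmonic quadratic component (`Δ p₂ = 0`). Architecture:

1. **Per direction** (`four_mul_dirSum_le_rectForm`): choosing an orthonormal basis `b'` through
   `ω = b' i₀` and `p'` with `𝓗_{b'} p' = 𝓗_b p` (`GaussianWickSpace`), `R_p(ω) = 4 · ME_{i₀}(p')`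
   (`GaussianRectangleForm.integral_rectIncr_sq_hermiteEval`), `ME` splits over homogeneous
   components, and on degree `n` the number-operator inequality
   (`FischerNumberOperator.four_mul_sub_le_sq_mul_mixedSum`) gives
   `ME(p'ₙ) ≥ (4/n²) ((n-1) ‖∂_{i₀} p'ₙ‖² - ‖∂²_{i₀} p'ₙ‖²)`; the intrinsic-chaos and derivative
   dictionary turn the right side into `(n-1) ‖D_ω pₙ‖²_F - ‖D_ω D_ω pₙ‖²_F` (basis `b`).
2. **Averaging over `ω`** (`LinearizedBoltzmannDirectionalForms`):
   `d ∫_S ‖D_ω pₙ‖² = σ n ‖pₙ‖²`, `d(d+2) ∫_S ‖D_ω² pₙ‖² = σ (‖Δpₙ‖² + 2n(n-1)‖pₙ‖²)`, and the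
   Fock bound `‖Δpₙ‖² ≤ n(n+d-2)‖pₙ‖²` (`FischerInnerProduct`) give the per-degree gap
   `16 σ (d-1)(n-2)/(d(d+2)n) ≥ κ_d` for `n ≥ 3`, `8σ/(d+2) ≥ κ_d` for `n = 2` (harmonic), `0` for
   `n ≤ 1` (absent by hypothesis).

This is the gap of the `ω`-isotropic (pseudo-Maxwellian) collision form; the hard-sphere gap
follows from it by the fibre coercivity (`LinearizedBoltzmannCoercivity1D`).
-/

open MeasureTheory Metric Real Set ProbabilityTheory Module Finset
open scoped InnerProductSpace ENNReal

namespace Literature.Analysis.UnboundedOperators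

noncomputable section

open Literature.MathematicalPhysics.KineticTheory (sphereMeasure)
open Literature.Algebra.Polynomial Literature.Probability.Distributions

variable {ι : Type*} [Fintype ι] [DecidableEq ι]

/-! ### Splitting over homogeneous components -/

omit [DecidableEq ι] in
/-- The support of the degree-`n` component is the degree-`n` part of the support. [folklore] -/
theorem support_homogeneousComponent_subset (n : ℕ) (p : MvPolynomial ι ℝ) :
    (MvPolynomial.homogeneousComponent n p).support ⊆ p.support.filter fun α => ∑ i, α i = n := by
  intro α hα
  rw [MvPolynomial.mem_support_iff, MvPolynomial.coeff_homogeneousComponent, Finsupp.degree_eq_sum] at hα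
  rw [Finset.mem_filter, MvPolynomial.mem_support_iff]
  by_cases h : ∑ i, α i = n
  · rw [if_pos h] at hα; exact ⟨hα, h⟩
  · rw [if_neg h] at hα; exact absurd rfl hα

omit [DecidableEq ι] in
/-- A coefficientwise sum over the support splits over the homogeneous components:
`Σ_{α ∈ supp p} f α (p_α) = Σ_{n ≤ N} Σ_{α ∈ supp pₙ} f α ((pₙ)_α)` for `deg p ≤ N`, provided
`f α 0 = 0`. [folklore] -/
theorem sum_support_eq_sum_homogeneousComponent {p : MvPolynomial ι ℝ} {N : ℕ} (hN : p.totalDegree ≤ N)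
    (f : (ι →₀ ℕ) → ℝ → ℝ) (hf : ∀ α, f α 0 = 0) :
    ∑ α ∈ p.support, f α (MvPolynomial.coeff α p) =
      ∑ n ∈ Finset.range (N + 1), ∑ α ∈ (MvPolynomial.homogeneousComponent n p).support,
        f α (MvPolynomial.coeff α (MvPolynomial.homogeneousComponent n p)) := by
  have hin : ∀ n, ∑ α ∈ (MvPolynomial.homogeneousComponent n p).support,
      f α (MvPolynomial.coeff α (MvPolynomial.homogeneousComponent n p)) =
      ∑ α ∈ p.support.filter (fun α => ∑ i, α i = n), f α (MvPolynomial.coeff α p) := by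
    intro n
    rw [Finset.sum_subset (support_homogeneousComponent_subset n p)]
    · refine Finset.sum_congr rfl fun α hα => ?_
      rw [Finset.mem_filter] at hα
      rw [MvPolynomial.coeff_homogeneousComponent, Finsupp.degree_eq_sum, if_pos hα.2]
    · intro α _ hα
      rw [MvPolynomial.notMem_support_iff.1 hα, hf]
  simp_rw [hin]
  rw [Finset.sum_fiberwise_of_maps_to]
  intro α hα
  rw [Finset.mem_range, Nat.lt_succ_iff]
  have := MvPolynomial.le_totalDegree hα
  rw [Finsupp.sum_fintype α (fun _ n => n) fun _ => rfl] at this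
  exact this.trans hN

/-- `‖p‖²_F = Σₙ ‖pₙ‖²_F`. [folklore] -/
theorem fischerInner_self_eq_sum_homogeneousComponent {p : MvPolynomial ι ℝ} {N : ℕ}
    (hN : p.totalDegree ≤ N) :
    fischerInner p p = ∑ n ∈ Finset.range (N + 1),
      fischerInner (MvPolynomial.homogeneousComponent n p) (MvPolynomial.homogeneousComponent n p) := by
  rw [fischerInner_self_eq]
  rw [sum_support_eq_sum_homogeneousComponent hN (fun α c => mfactorial α * c ^ 2) (fun α => by simp)]
  refine Finset.sum_congr rfl fun n _ => ?_
  rw [fischerInner_self_eq]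

/-- The mixed energy splits over homogeneous components. [folklore] -/
theorem mixedEnergy_eq_sum_homogeneousComponent (i₀ : ι) {p : MvPolynomial ι ℝ} {N : ℕ}
    (hN : p.totalDegree ≤ N) :
    mixedEnergy i₀ p = ∑ n ∈ Finset.range (N + 1), mixedEnergy i₀ (MvPolynomial.homogeneousComponent n p) := by
  unfold mixedEnergy
  rw [sum_support_eq_sum_homogeneousComponent hN
    (fun α c => if 1 ≤ α i₀ ∧ α.erase i₀ ≠ 0 then mfactorial α * c ^ 2 else 0) (fun α => by simp)]

/-- `(n - 1) ‖∂ᵢ r‖² ≥ ‖∂ᵢ² r‖²` for `r` homogeneous of degree `n`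
(`= Σ_α αᵢ (n - αᵢ) α! r_α² ≥ 0`). [folklore] -/
theorem fischerInner_pderiv_pderiv_le {r : MvPolynomial ι ℝ} {n : ℕ} (hr : r.IsHomogeneous n) (i : ι) :
    fischerInner (MvPolynomial.pderiv i (MvPolynomial.pderiv i r)) (MvPolynomial.pderiv i (MvPolynomial.pderiv i r)) ≤
      ((n : ℝ) - 1) * fischerInner (MvPolynomial.pderiv i r) (MvPolynomial.pderiv i r) := by
  rw [fischerInner_pderiv_pderiv_self_eq_sum, fischerInner_pderiv_self_eq_sum, Finset.mul_sum]
  refine Finset.sum_le_sum fun α hα => ?_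
  have hsum := sum_eq_of_mem_support_of_isHomogeneous hr hα
  have hale : α i ≤ n := by
    rw [← hsum]
    exact Finset.single_le_sum (fun j _ => Nat.zero_le (α j)) (Finset.mem_univ i)
  have hw : 0 ≤ mfactorial α * MvPolynomial.coeff α r ^ 2 := mul_nonneg (mfactorial_pos α).le (sq_nonneg _)
  have hcast : (α i : ℝ) ≤ n := by exact_mod_cast hale
  nlinarith [mul_nonneg (Nat.cast_nonneg (α i)) hw, mul_nonneg (sub_nonneg.2 hcast) hw,
    mul_nonneg (mul_nonneg (Nat.cast_nonneg (α i)) (sub_nonneg.2 hcast)) hw]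

/-! ### The adapted basis and the per-direction estimate -/

section PerDirection

variable {E : Type*} [NormedAddCommGroup E] [InnerProductSpace ℝ E] [FiniteDimensional ℝ E]
  [MeasurableSpace E] [BorelSpace E]

/-- **Adapted coordinates.** For a unit vector `ω` and a polynomial `p` of degree `≤ N` there are an
orthonormal basis `b'` through `ω = b' i₀` and `p'` of degree `≤ N` with `𝓗_{b'} p' = 𝓗_b p`, such
that for every degree `n` the Fischer norms of `∂_{i₀} p'ₙ` and `∂²_{i₀} p'ₙ` are the direction
forms `‖D_ω pₙ‖²_F`, `‖D_ω D_ω pₙ‖²_F` computed in the basis `b`. [folklore] -/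
theorem exists_adapted (hcard : finrank ℝ E = Fintype.card ι) (b : OrthonormalBasis ι ℝ E)
    (p : MvPolynomial ι ℝ) {N : ℕ} (hN : p.totalDegree ≤ N) (ω : sphere (0 : E) 1) :
    ∃ (b' : OrthonormalBasis ι ℝ E) (i₀ : ι) (p' : MvPolynomial ι ℝ),
      b' i₀ = ω ∧ p'.totalDegree ≤ N ∧ hermiteEval b' p' = hermiteEval b p ∧
      ∀ n, fischerInner (MvPolynomial.pderiv i₀ (MvPolynomial.homogeneousComponent n p'))
            (MvPolynomial.pderiv i₀ (MvPolynomial.homogeneousComponent n p')) =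
          fischerInner (dirPoly b ω (MvPolynomial.homogeneousComponent n p))
            (dirPoly b ω (MvPolynomial.homogeneousComponent n p)) ∧
        fischerInner (MvPolynomial.pderiv i₀ (MvPolynomial.pderiv i₀ (MvPolynomial.homogeneousComponent n p')))
            (MvPolynomial.pderiv i₀ (MvPolynomial.pderiv i₀ (MvPolynomial.homogeneousComponent n p'))) =
          fischerInner (dirPoly b ω (dirPoly b ω (MvPolynomial.homogeneousComponent n p)))
            (dirPoly b ω (dirPoly b ω (MvPolynomial.homogeneousComponent n p))) := by
  -- `ι` is nonempty since `E` contains the unit vector `ω`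
  have hω : ‖(ω : E)‖ = 1 := norm_eq_of_mem_sphere ω
  have hne : Nonempty ι := by
    have h0 : (ω : E) ≠ 0 := by
      intro h; rw [h, norm_zero] at hω; exact zero_ne_one hω
    have : 0 < finrank ℝ E := Module.finrank_pos_iff_exists_ne_zero.2 ⟨ω, h0⟩
    rw [hcard] at this
    exact Fintype.card_pos_iff.1 this
  obtain ⟨i₀⟩ := hne
  -- an orthonormal basis through `ω`
  have hv : Orthonormal ℝ (({i₀} : Set ι).restrict fun _ : ι => (ω : E)) := by
    refine ⟨fun i => by simp [hω], ?_⟩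
    intro i j hij
    exact absurd (Subsingleton.elim i j) hij
  obtain ⟨b', hb'⟩ := hv.exists_orthonormalBasis_extension_of_card_eq hcard
  have hb'ω : b' i₀ = ω := hb' i₀ rfl
  obtain ⟨p', hp'N, hp'eq⟩ := exists_hermiteEval_eq b b' hN
  refine ⟨b', i₀, p', hb'ω, hp'N, hp'eq, fun n => ?_⟩
  set r := MvPolynomial.homogeneousComponent n p' with hr
  set r₀ := MvPolynomial.homogeneousComponent n p with hr₀
  have F1 : hermiteEval b' r = hermiteEval b r₀ := hermiteEval_homogeneousComponent_eq b' b hp'eq n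
  have F2 : hermiteEval b' (MvPolynomial.pderiv i₀ r) = hermiteEval b (dirPoly b ω r₀) := by
    funext v
    rw [← dirPoly_basis b' i₀ r, ← fderiv_hermiteEval_eq_dirPoly, ← fderiv_hermiteEval_eq_dirPoly, F1,
      hb'ω]
  have F3 : hermiteEval b' (MvPolynomial.pderiv i₀ (MvPolynomial.pderiv i₀ r)) =
      hermiteEval b (dirPoly b ω (dirPoly b ω r₀)) := by
    funext v
    rw [← dirPoly_basis b' i₀ (MvPolynomial.pderiv i₀ r), ← fderiv_hermiteEval_eq_dirPoly,
      ← fderiv_hermiteEval_eq_dirPoly, F2, hb'ω]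
  constructor
  · rw [← integral_hermiteEval_sq b', ← integral_hermiteEval_sq b, F2]
  · rw [← integral_hermiteEval_sq b', ← integral_hermiteEval_sq b, F3]

/-- The per-degree summand of the direction sum is nonnegative:
`‖D_ω D_ω pₙ‖²_F ≤ (n - 1) ‖D_ω pₙ‖²_F` for a unit vector `ω`. [folklore] -/
theorem dirFormB_le_dirFormA (hcard : finrank ℝ E = Fintype.card ι) (b : OrthonormalBasis ι ℝ E)
    (p : MvPolynomial ι ℝ) (n : ℕ) (ω : sphere (0 : E) 1) :
    fischerInner (dirPoly b ω (dirPoly b ω (MvPolynomial.homogeneousComponent n p)))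
        (dirPoly b ω (dirPoly b ω (MvPolynomial.homogeneousComponent n p))) ≤
      ((n : ℝ) - 1) * fischerInner (dirPoly b ω (MvPolynomial.homogeneousComponent n p))
        (dirPoly b ω (MvPolynomial.homogeneousComponent n p)) := by
  obtain ⟨b', i₀, p', -, -, -, hdict⟩ := exists_adapted hcard b p le_rfl ω
  obtain ⟨hA, hB⟩ := hdict n
  rw [← hA, ← hB]
  exact fischerInner_pderiv_pderiv_le (MvPolynomial.homogeneousComponent_isHomogeneous n p') i₀

/-- **The per-direction estimate**: for a unit vector `ω` and `deg p ≤ N`,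
`4 Σ_{n ≤ N} (4/n²) ((n-1) ‖D_ω pₙ‖²_F - ‖D_ω D_ω pₙ‖²_F) ≤ ∫ (R_ω 𝓗_b p)²`. [folklore] -/
theorem four_mul_dirSum_le_rectForm (hcard : finrank ℝ E = Fintype.card ι) (b : OrthonormalBasis ι ℝ E)
    (p : MvPolynomial ι ℝ) {N : ℕ} (hN : p.totalDegree ≤ N) (ω : sphere (0 : E) 1) :
    4 * ∑ n ∈ Finset.range (N + 1), (4 : ℝ) / (n : ℝ) ^ 2 *
        (((n : ℝ) - 1) * fischerInner (dirPoly b ω (MvPolynomial.homogeneousComponent n p))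
            (dirPoly b ω (MvPolynomial.homogeneousComponent n p)) -
          fischerInner (dirPoly b ω (dirPoly b ω (MvPolynomial.homogeneousComponent n p)))
            (dirPoly b ω (dirPoly b ω (MvPolynomial.homogeneousComponent n p)))) ≤
      ∫ q, rectIncr (ω : E) (hermiteEval b p) q ^ 2
        ∂(((gaussianReal 0 1).prod (gaussianReal 0 1)).prod ((stdGaussian E).prod (stdGaussian E))) := by
  obtain ⟨b', i₀, p', hb'ω, hp'N, hp'eq, hdict⟩ := exists_adapted hcard b p hN ω
  have hint : ∫ q, rectIncr (ω : E) (hermiteEval b p) q ^ 2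
      ∂(((gaussianReal 0 1).prod (gaussianReal 0 1)).prod ((stdGaussian E).prod (stdGaussian E))) =
      4 * mixedEnergy i₀ p' := by
    rw [← hb'ω, ← hp'eq]
    exact integral_rectIncr_sq_hermiteEval b' i₀ p'
  rw [hint, mixedEnergy_eq_sum_homogeneousComponent i₀ hp'N, Finset.mul_sum, Finset.mul_sum]
  refine Finset.sum_le_sum fun n _ => ?_
  refine mul_le_mul_of_nonneg_left ?_ (by norm_num)
  obtain ⟨hA, hB⟩ := hdict n
  rw [← hA, ← hB]
  have hhom := MvPolynomial.homogeneousComponent_isHomogeneous n p'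
  have hme := four_mul_sub_le_sq_mul_mixedSum hhom i₀
  -- the right-hand sum of `hme` is `mixedEnergy i₀ (p'ₙ)` by definition
  change 4 * _ ≤ (n : ℝ) ^ 2 * mixedEnergy i₀ (MvPolynomial.homogeneousComponent n p') at hme
  have hME := mixedEnergy_nonneg i₀ (MvPolynomial.homogeneousComponent n p')
  rcases Nat.eq_zero_or_pos n with h0 | hpos
  · subst h0
    simp only [Nat.cast_zero, ne_eq, OfNat.ofNat_ne_zero, not_false_eq_true, zero_pow, div_zero,
      zero_mul]
    exact hME
  · have hn2 : (0 : ℝ) < (n : ℝ) ^ 2 := by positivity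
    rw [div_mul_eq_mul_div, div_le_iff₀ hn2]
    linarith

end PerDirection

/-! ### Averaging over the sphere: the polynomial gap -/

section Gap

variable {E : Type*} [NormedAddCommGroup E] [InnerProductSpace ℝ E] [FiniteDimensional ℝ E]
  [MeasurableSpace E] [BorelSpace E]

/-- The per-degree sphere average: for `pₙ` homogeneous of degree `n` (`d = dim E ≥ 1`),
`∫_S [ (n-1)‖D_ω pₙ‖² - ‖D_ω D_ω pₙ‖² ] dσ
  = σ(S) [ (n-1) n ‖pₙ‖² / d - (‖Δpₙ‖² + 2n(n-1)‖pₙ‖²)/(d(d+2)) ]`. [folklore] -/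
theorem integral_sphere_dirDiff {q : MvPolynomial ι ℝ} {n : ℕ} (b : OrthonormalBasis ι ℝ E)
    (hq : q.IsHomogeneous n) (hE : 0 < finrank ℝ E) (hcard : finrank ℝ E = Fintype.card ι) :
    ∫ ω : sphere (0 : E) 1, (((n : ℝ) - 1) * fischerInner (dirPoly b ω q) (dirPoly b ω q) -
        fischerInner (dirPoly b ω (dirPoly b ω q)) (dirPoly b ω (dirPoly b ω q))) ∂sphereMeasure =
      (sphereMeasure (univ : Set (sphere (0 : E) 1))).toReal *
        (((n : ℝ) - 1) * (n * fischerInner q q) / (finrank ℝ E : ℝ) -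
          (fischerInner (∑ j, MvPolynomial.pderiv j (MvPolynomial.pderiv j q))
              (∑ j, MvPolynomial.pderiv j (MvPolynomial.pderiv j q)) +
            2 * (n * (n - 1 : ℕ) * fischerInner q q)) / ((finrank ℝ E : ℝ) * (finrank ℝ E + 2))) := by
  have hd : (0 : ℝ) < finrank ℝ E := by exact_mod_cast hE
  have hA := integral_sphere_dirFormA b hq hE
  have hB := integral_sphere_dirFormB b hq hE
  rw [← hcard] at hA hB
  have iA : Integrable (fun ω : sphere (0 : E) 1 => fischerInner (dirPoly b ω q) (dirPoly b ω q))
      sphereMeasure := integrable_sphere_of_continuous (continuous_fischerInner_dirPoly b q)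
  have iB : Integrable (fun ω : sphere (0 : E) 1 =>
      fischerInner (dirPoly b ω (dirPoly b ω q)) (dirPoly b ω (dirPoly b ω q))) sphereMeasure :=
    integrable_sphere_of_continuous (continuous_fischerInner_dirPoly_dirPoly b q)
  rw [integral_sub (iA.const_mul _) iB, integral_const_mul]
  have eA : ∫ ω : sphere (0 : E) 1, fischerInner (dirPoly b ω q) (dirPoly b ω q) ∂sphereMeasure =
      (sphereMeasure (univ : Set (sphere (0 : E) 1))).toReal * (n * fischerInner q q) / finrank ℝ E := by
    rw [eq_div_iff hd.ne', mul_comm, hA]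
  have eB : ∫ ω : sphere (0 : E) 1,
      fischerInner (dirPoly b ω (dirPoly b ω q)) (dirPoly b ω (dirPoly b ω q)) ∂sphereMeasure =
      (sphereMeasure (univ : Set (sphere (0 : E) 1))).toReal *
        (fischerInner (∑ j, MvPolynomial.pderiv j (MvPolynomial.pderiv j q))
            (∑ j, MvPolynomial.pderiv j (MvPolynomial.pderiv j q)) +
          2 * (n * (n - 1 : ℕ) * fischerInner q q)) / ((finrank ℝ E : ℝ) * (finrank ℝ E + 2)) := by
    rw [eq_div_iff (by positivity), mul_comm, hB]
  rw [eA, eB]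
  ring

/-- **Per-degree gap arithmetic.** For `pₙ` homogeneous of degree `n` in dimension `d ≥ 2`, with
`pₙ = 0` if `n ≤ 1` and `Δ pₙ = 0` if `n = 2`:
`(4/n²) ∫_S [ (n-1)‖D_ω pₙ‖² - ‖D_ω² pₙ‖² ] dσ ≥ (4 (d-1) / (3 d (d+2))) σ(S) ‖pₙ‖²`. [folklore] -/
theorem gap_per_degree {q : MvPolynomial ι ℝ} {n : ℕ} (b : OrthonormalBasis ι ℝ E)
    (hq : q.IsHomogeneous n) (hd2 : 2 ≤ finrank ℝ E) (hcard : finrank ℝ E = Fintype.card ι)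
    (h01 : n ≤ 1 → q = 0)
    (h2 : n = 2 → ∑ j, MvPolynomial.pderiv j (MvPolynomial.pderiv j q) = 0) :
    4 * ((finrank ℝ E : ℝ) - 1) / (3 * finrank ℝ E * (finrank ℝ E + 2)) *
        (sphereMeasure (univ : Set (sphere (0 : E) 1))).toReal * fischerInner q q ≤
      (4 : ℝ) / (n : ℝ) ^ 2 * ∫ ω : sphere (0 : E) 1,
        (((n : ℝ) - 1) * fischerInner (dirPoly b ω q) (dirPoly b ω q) -
          fischerInner (dirPoly b ω (dirPoly b ω q)) (dirPoly b ω (dirPoly b ω q))) ∂sphereMeasure := by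
  have hE : 0 < finrank ℝ E := by omega
  rw [integral_sphere_dirDiff b hq hE hcard]
  set d : ℝ := (finrank ℝ E : ℝ) with hdd
  set S : ℝ := (sphereMeasure (univ : Set (sphere (0 : E) 1))).toReal with hS
  have hd2' : (2 : ℝ) ≤ d := by rw [hdd]; exact_mod_cast hd2
  have hd0 : 0 < d := by linarith
  have hS0 : 0 ≤ S := ENNReal.toReal_nonneg
  have hP : 0 ≤ fischerInner q q := fischerInner_self_nonneg q
  set P := fischerInner q q with hPdef
  set L := fischerInner (∑ j, MvPolynomial.pderiv j (MvPolynomial.pderiv j q))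
      (∑ j, MvPolynomial.pderiv j (MvPolynomial.pderiv j q)) with hLdef
  have hL0 : 0 ≤ L := fischerInner_self_nonneg _
  have hLle : L ≤ n * (n + d - 2) * P := by
    have := fischerInner_laplacian_self_le (ι := ι) hq
    rw [← hcard] at this
    exact this
  rcases Nat.lt_or_ge n 2 with hn | hn
  · -- `n ≤ 1`: `q = 0`
    have hq0 : q = 0 := h01 (by omega)
    have hP0 : P = 0 := by rw [hPdef, hq0]; simp [fischerInner]
    have hL00 : L = 0 := by rw [hLdef, hq0]; simp [fischerInner]
    rw [hP0, hL00]
    simp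
  · rcases Nat.eq_or_lt_of_le hn with h2n | h3n
    · -- `n = 2`: harmonic
      have hL00 : L = 0 := by rw [hLdef, h2 h2n.symm]; simp [fischerInner]
      subst h2n
      rw [hL00]
      have e : (4 : ℝ) / ((2 : ℕ) : ℝ) ^ 2 * (S * ((((2 : ℕ) : ℝ) - 1) * ((2 : ℕ) * P) / d -
          (0 + 2 * ((2 : ℕ) * ((2 - 1 : ℕ) : ℝ) * P)) / (d * (d + 2)))) = 2 * S * P / (d + 2) := by
        push_cast
        field_simp
        ring
      rw [e, show 4 * (d - 1) / (3 * d * (d + 2)) * S * P = 4 * (d - 1) * S * P / (3 * d * (d + 2)) by ring,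
        div_le_div_iff₀ (by positivity) (by positivity)]
      nlinarith [mul_nonneg (mul_nonneg hS0 hP) (by linarith : (0 : ℝ) ≤ d + 2), mul_nonneg hS0 hP]
    · -- `n ≥ 3`
      have hn3 : (3 : ℝ) ≤ n := by exact_mod_cast h3n
      have hnpos : (0 : ℝ) < n := by linarith
      have hcast : ((n - 1 : ℕ) : ℝ) = n - 1 := by
        rw [Nat.cast_sub (by omega), Nat.cast_one]
      rw [hcast]
      have hRHS : (4 : ℝ) / (n : ℝ) ^ 2 * (S * (((n : ℝ) - 1) * (n * P) / d -
          (n * (n + d - 2) * P + 2 * (n * (n - 1) * P)) / (d * (d + 2)))) ≤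
          (4 : ℝ) / (n : ℝ) ^ 2 * (S * (((n : ℝ) - 1) * (n * P) / d -
            (L + 2 * (n * (n - 1) * P)) / (d * (d + 2)))) := by
        gcongr
      refine le_trans ?_ hRHS
      have hval : (4 : ℝ) / (n : ℝ) ^ 2 * (S * (((n : ℝ) - 1) * (n * P) / d -
          (n * (n + d - 2) * P + 2 * (n * (n - 1) * P)) / (d * (d + 2)))) =
          4 * (d - 1) * (n - 2) * S * P / (n * d * (d + 2)) := by
        field_simp
        ring
      rw [hval, show 4 * (d - 1) / (3 * d * (d + 2)) * S * P = 4 * (d - 1) * S * P / (3 * d * (d + 2)) by ring,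
        div_le_div_iff₀ (by positivity) (by positivity)]
      have hfac : 0 ≤ (d - 1) * S * P * (d * (d + 2)) := by
        have : 0 ≤ d - 1 := by linarith
        positivity
      nlinarith [hfac, hn3]

/-- **The polynomial spectral gap of the rectangle form** (pseudo-Maxwellian gap): in dimension
`d ≥ 2`, for a polynomial `p` whose degree-`0` and degree-`1` components vanish and whose quadratic
component is harmonic,
`κ_d ‖p‖²_F ≤ ∫_S (∫ (R_ω 𝓗_b p)²) dσ(ω)` with `κ_d = 16 σ(S) (d-1)/(3d(d+2))`, as an inequality of
extended nonnegative reals. [folklore] -/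
theorem lintegral_sphere_rectForm_ge (hd2 : 2 ≤ finrank ℝ E) (hcard : finrank ℝ E = Fintype.card ι)
    (b : OrthonormalBasis ι ℝ E) (p : MvPolynomial ι ℝ)
    (h0 : MvPolynomial.homogeneousComponent 0 p = 0) (h1 : MvPolynomial.homogeneousComponent 1 p = 0)
    (h2 : ∑ j, MvPolynomial.pderiv j (MvPolynomial.pderiv j (MvPolynomial.homogeneousComponent 2 p)) = 0) :
    ENNReal.ofReal (16 * ((finrank ℝ E : ℝ) - 1) / (3 * finrank ℝ E * (finrank ℝ E + 2)) *
        (sphereMeasure (univ : Set (sphere (0 : E) 1))).toReal * fischerInner p p) ≤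
      ∫⁻ ω : sphere (0 : E) 1, ENNReal.ofReal (∫ q, rectIncr (ω : E) (hermiteEval b p) q ^ 2
        ∂(((gaussianReal 0 1).prod (gaussianReal 0 1)).prod ((stdGaussian E).prod (stdGaussian E))))
        ∂sphereMeasure := by
  set N := p.totalDegree with hNdef
  -- the direction sum `T(ω)` and its properties
  set T : sphere (0 : E) 1 → ℝ := fun ω => ∑ n ∈ Finset.range (N + 1), (4 : ℝ) / (n : ℝ) ^ 2 *
      (((n : ℝ) - 1) * fischerInner (dirPoly b ω (MvPolynomial.homogeneousComponent n p))
          (dirPoly b ω (MvPolynomial.homogeneousComponent n p)) -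
        fischerInner (dirPoly b ω (dirPoly b ω (MvPolynomial.homogeneousComponent n p)))
          (dirPoly b ω (dirPoly b ω (MvPolynomial.homogeneousComponent n p)))) with hT
  have hT0 : ∀ ω, 0 ≤ T ω := fun ω =>
    Finset.sum_nonneg fun n _ => mul_nonneg (by positivity)
      (sub_nonneg.2 (dirFormB_le_dirFormA hcard b p n ω))
  have hTle : ∀ ω, 4 * T ω ≤ ∫ q, rectIncr (ω : E) (hermiteEval b p) q ^ 2
      ∂(((gaussianReal 0 1).prod (gaussianReal 0 1)).prod ((stdGaussian E).prod (stdGaussian E))) :=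
    fun ω => four_mul_dirSum_le_rectForm hcard b p le_rfl ω
  have hTc : Continuous fun ω : sphere (0 : E) 1 => T ω := by
    simp only [hT]
    refine continuous_finsetSum _ fun n _ => Continuous.mul continuous_const (Continuous.sub
      (Continuous.mul continuous_const ((continuous_fischerInner_dirPoly b _).comp continuous_subtype_val))
      ((continuous_fischerInner_dirPoly_dirPoly b _).comp continuous_subtype_val))
  have hTi : Integrable (fun ω : sphere (0 : E) 1 => 4 * T ω) sphereMeasure := by
    obtain ⟨C, hC⟩ := (isCompact_univ (X := sphere (0 : E) 1)).exists_bound_of_continuousOn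
      hTc.continuousOn
    exact ((integrable_const C).mono' hTc.aestronglyMeasurable
      (ae_of_all _ fun ω => hC ω (mem_univ ω))).const_mul 4
  -- `∫⁻ ofReal R ≥ ∫⁻ ofReal (4T) = ofReal (∫ 4T)`
  calc ENNReal.ofReal _ ≤ ENNReal.ofReal (∫ ω : sphere (0 : E) 1, 4 * T ω ∂sphereMeasure) := by
        refine ENNReal.ofReal_le_ofReal ?_
        -- the averaged arithmetic
        rw [integral_const_mul, hT, integral_finsetSum _ fun n _ => ?_]
        · have hE : 0 < finrank ℝ E := by omega
          have hsum := fischerInner_self_eq_sum_homogeneousComponent (p := p) (le_refl N)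
          rw [hsum, Finset.mul_sum, Finset.mul_sum]
          refine Finset.sum_le_sum fun n _ => ?_
          rw [integral_const_mul]
          have hg := gap_per_degree (E := E) b (MvPolynomial.homogeneousComponent_isHomogeneous n p) hd2 hcard
            (fun hn => by
              interval_cases n
              · exact h0
              · exact h1)
            (fun hn => by subst hn; exact h2)
          calc 16 * ((finrank ℝ E : ℝ) - 1) / (3 * finrank ℝ E * (finrank ℝ E + 2)) *
                (sphereMeasure (univ : Set (sphere (0 : E) 1))).toReal *
                fischerInner (MvPolynomial.homogeneousComponent n p) (MvPolynomial.homogeneousComponent n p)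
              = 4 * (4 * ((finrank ℝ E : ℝ) - 1) / (3 * finrank ℝ E * (finrank ℝ E + 2)) *
                (sphereMeasure (univ : Set (sphere (0 : E) 1))).toReal *
                fischerInner (MvPolynomial.homogeneousComponent n p)
                  (MvPolynomial.homogeneousComponent n p)) := by ring
            _ ≤ 4 * ((4 : ℝ) / (n : ℝ) ^ 2 * ∫ ω : sphere (0 : E) 1,
                (((n : ℝ) - 1) * fischerInner (dirPoly b ω (MvPolynomial.homogeneousComponent n p))
                    (dirPoly b ω (MvPolynomial.homogeneousComponent n p)) -
                  fischerInner (dirPoly b ω (dirPoly b ω (MvPolynomial.homogeneousComponent n p)))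
                    (dirPoly b ω (dirPoly b ω (MvPolynomial.homogeneousComponent n p)))) ∂sphereMeasure) :=
                mul_le_mul_of_nonneg_left hg (by norm_num)
        · exact (Integrable.sub ((integrable_sphere_of_continuous (continuous_fischerInner_dirPoly b _)).const_mul _)
            (integrable_sphere_of_continuous (continuous_fischerInner_dirPoly_dirPoly b _))).const_mul _
    _ = ∫⁻ ω : sphere (0 : E) 1, ENNReal.ofReal (4 * T ω) ∂sphereMeasure :=
        (ofReal_integral_eq_lintegral_ofReal hTi (ae_of_all _ fun ω => by
          have := hT0 ω; positivity)).trans rfl |> fun h => by rw [h]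
    _ ≤ _ := lintegral_mono fun ω => ENNReal.ofReal_le_ofReal (hTle ω)

end Gap

end

end Literature.Analysis.UnboundedOperators
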